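import Summits.BirchSwinnertonDyer.Rank1Residual.Additive.X4RankZeroVisibleRefinedCertificateSockets
import Summits.BirchSwinnertonDyer.Rank1Residual.GaloisImage.LocalH1TorsionBounded
import Literature.NumberTheory.EllipticCurves.Rank1Residual.AnomalousDictionaryProofs
import HarnessLib

/-!
# Record socket over the REFINED seven-kind visibility certificate, prime-list form, ONE paid TAME place
# (cell `b2b-bsdres`, team n1011, ROW T-D44T-REC plumbing for the eight rank-3 `d1->T` rows of route planner 1's
# D44-T road; seat p09 GEN 13; lead R5-95 (g) ST-50d; the `ℓ ≠ 3` twin of n1011-p04's T-2LL FILE 6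
# `X4RankZero.bsdp_three_potMult_of_congr_of_places₇_of_primeList_paidThree`)

HONEST FRAMING (cell `b2b-bsdres`, run/shared/lean/b2b/bsd-rank1-residual/, verbatim in every
file): the goal of the cell is to DELETE the COMBINATION-SHAPED residual classes of the
Birch–Swinnerton-Dyer formula for ALL analytic-rank `≤ 1` elliptic curves over `ℚ` — "full BSD
formula for every rank `≤ 1` curve in class `C`" assembled STRICTLY from published theorems — so
that the rank-`≤ 1` remainder becomes exactly the CONSTRUCTION-SHAPED classes, which are TYPED
(missing-input `Prop`s), NOT attempted. This is not "finishing BSD". Team n1011 (N10 / N11, the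
additive block X4 ∧ `p = 3`): research route on the CONSTRUCTION-SHAPED class X4; no claim beyond
the stated classes; nothing is booked; no mark / label / count / road letter is changed by this file.
Theorems only (no definition, no new named fact, no `sorry`).  The socket is CONDITIONAL on the displayed
named facts of n1011-p04's X4 ∧ `r = 0` (M)-END (`X4RankZero.bsdp_three_potMult_of_congr_of_places₇`,
T-2LL FILE 5) and CLOSES NOTHING by itself: a per-row RECORD discharges `θ`, the integer models and
discriminant supports, `#E′(ℚ_ℓ)[3] ≤ t` at the paid place and every disjunct of `hplaces` in the kernel,
and carries `hr`, `hq`/`hv`, `hrank` as EVIDENCE binders (ruling of record for row shapes, n1011 lead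
R5-82 (d)).

## What

Route planner 1's D44-T road (ROUTE-1 §44.3 "PASS-TD": `route1/g37_d44_serv.tsv`) has 8 rows with
`rank E′ = 3` and ONE tame place `ℓ ≠ 3` that no free kind serves (`d1->T`: e.g. `E` split / `E′` good
with `#E′(ℚ_ℓ)[3] = 3`); it is PAID: `T = {v_ℓ}`, crude factor `#E′(ℚ_ℓ)[3] · #(ℤ_ℓ/3ℤ_ℓ) = #E′(ℚ_ℓ)[3] ≤ t`
(`#(ℤ_ℓ/3ℤ_ℓ) = 1` for `ℓ ≠ 3`, the tree's `natCard_quot_adicCompletionIntegers_eq_one_of_not_mem`)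
against the budget `t < 3^k`, `k ≤ rank E′(ℚ)`.

* `exists_paidPlace_prime` — plumbing: `T = {v_ℓ}` inside the places `S` over a list `L ∋ ℓ`, `ℓ ≠ 3`;
* `X4RankZero.bsdp_three_potMult_of_congr_of_places₇_of_primeList_paidAt` — (M) rows, the place of
  `ℓ ≠ 3` paid, every OTHER place over `L` of one of the seven kinds (verbatim FILE 6's `…_paidThree`
  with `3 ↦ ℓ` in `htors` / the exclusion of `hplaces` and the budget `t < 3^k`).

References: [CremonaMazur2000] §3 and Table 1; [AgasheStein2002] Thm. 3.1; [Delbourgo1998] Prop. 4;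
[SilvermanAEC2009] X.4.2, X.4.14; [SilvermanATAEC1994] Ch. V; [MilneADT2006] Ch. I Lemma 3.3;
cells/n1011/ROUTE-1.md §44.3, §49.3, §50.2.
-/

set_option autoImplicit false

noncomputable section

open scoped Classical NumberField
open IsDedekindDomain NumberField WeierstrassCurve Rat.HeightOneSpectrum
  Literature.NumberTheory.EllipticCurves Literature.NumberTheory.EllipticCurves.ModularForms
  Literature.NumberTheory.EllipticCurves.Rank1Residual
  Literature.NumberTheory.EllipticCurves.Rank1Residual.Typed
  Literature.NumberTheory.GaloisRepresentations
  Summit.BirchSwinnertonDyer.Rank1Residual.GaloisImage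

namespace Summit.BirchSwinnertonDyer.Rank1Residual.Additive

/-! ### §1. Records plumbing: one prime `ℓ ≠ 3` as the single PAID place -/

/-- **The single paid place `ℓ ≠ 3`** (records plumbing, no content): with `S` the places over a list
`L ∋ ℓ`, the set `T = {v_ℓ}` satisfies `T ⊆ S`, every `w ∈ S ∖ T` has `ℓ_w ≠ ℓ`, and the crude factor on
`T` is `#E′(ℚ_ℓ)[3] · #(ℤ_ℓ/3ℤ_ℓ) = #E′(ℚ_ℓ)[3] ≤ t < 3^k ≤ 3^{rank E′}` (`#(ℤ_ℓ/3ℤ_ℓ) = 1` since `3` is an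
`ℓ`-adic unit: `natCard_quot_adicCompletionIntegers_eq_one_of_not_mem`). [cite: MilneADT2006, Ch. I Lemma 3.3] -/
theorem exists_paidPlace_prime (W' : WeierstrassCurve ℚ) (L : List ℕ) (ℓ : ℕ)
    [hℓ : Fact ℓ.Prime] (hℓ3 : ℓ ≠ 3) (hℓL : ℓ ∈ L) {S : Finset (HeightOneSpectrum (𝓞 ℚ))}
    (hS : ∀ v : HeightOneSpectrum (𝓞 ℚ), v ∈ S ↔ (primesEquiv v : ℕ) ∈ L) {t k : ℕ}
    (htors : ∀ w : HeightOneSpectrum (𝓞 ℚ), (primesEquiv w : ℕ) = ℓ →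
      Nat.card (nsmulAddMonoidHom 3 :
        (W'.baseChange (w.adicCompletion ℚ)).toAffine.Point →+ _).ker ≤ t)
    (hbudget : t < 3 ^ k) (hrank : k ≤ W'.mordellWeilRank) :
    ∃ T : Finset (HeightOneSpectrum (𝓞 ℚ)), T ⊆ S ∧
      (∏ w ∈ T, Nat.card (nsmulAddMonoidHom 3 :
        (W'.baseChange (w.adicCompletion ℚ)).toAffine.Point →+ _).ker *
        Nat.card (w.adicCompletionIntegers ℚ ⧸
          Ideal.span {((3 : ℕ) : w.adicCompletionIntegers ℚ)})) < 3 ^ W'.mordellWeilRank ∧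
      ∀ w ∈ S, w ∉ T → (primesEquiv w : ℕ) ≠ ℓ := by
  set vℓ : HeightOneSpectrum (𝓞 ℚ) := (primesEquiv (R := 𝓞 ℚ)).symm ⟨ℓ, hℓ.out⟩ with hvℓ
  have hℓv : (primesEquiv vℓ : ℕ) = ℓ := by rw [hvℓ, Equiv.apply_symm_apply]
  have h3v : ((3 : ℕ) : 𝓞 ℚ) ∉ vℓ.asIdeal :=
    natCast_not_mem_asIdeal_of_primesEquiv_ne Nat.prime_three (by rw [hℓv]; exact hℓ3)
  refine ⟨{vℓ}, Finset.singleton_subset_iff.mpr ((hS vℓ).mpr (by rw [hℓv]; exact hℓL)), ?_,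
    fun w _ hw hwℓ ↦ hw ?_⟩
  · rw [Finset.prod_singleton, natCard_quot_adicCompletionIntegers_eq_one_of_not_mem vℓ h3v, mul_one]
    calc _ ≤ t := htors vℓ hℓv
      _ < 3 ^ k := hbudget
      _ ≤ 3 ^ W'.mordellWeilRank := Nat.pow_le_pow_right (by norm_num) hrank
  · rw [Finset.mem_singleton]
    exact (primesEquiv (R := 𝓞 ℚ)).injective (Subtype.ext (hwℓ.trans hℓv.symm))

/-! ### §2. The record socket, (M) rows, one paid tame place -/

/-- **Record socket, (M) rows, the place of a prime `ℓ ≠ 3` PAID** (route planner 1's D44-T `d1->T`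
shape: `rank E′ = 3`, one tame place with `#E′(ℚ_ℓ)[3] = 3` that no free kind serves): `BSD(E,3)` for
an X4 ∧ `r_an = 0` row `E = W`, potentially multiplicative at `3`, `ρ̄_{E,3}` onto, `ord₃ #Ш_an ≤ 2`,
from a `3`-congruent partner `E′ = W′` with `#E′(ℚ_ℓ)[3] ≤ t`, `t < 3^k`, `k ≤ rank E′(ℚ)`, whose place
over every OTHER prime of a list `L ∋ 3, ℓ` supporting both discriminants is of kind (i), (ii), (iii),
(iv′), (vi), (iii′) or (vii).  Displayed: the (M)-END's facts, A40/A41 `hU`/`hU2`, `hr`, `hq`/`hv`,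
`θ`/`hθ`, `hrank` — EVIDENCE columns of a record; closes nothing beyond them.
[cite: CremonaMazur2000, §3 and Table 1] [cite: AgasheStein2002, Thm. 3.1]
[cite: SilvermanATAEC1994, Ch. V Lemma 5.2 (c), Thm. 5.3, Cor. 5.4] [cite: Delbourgo1998, Prop. 4 (p. 144)] -/
theorem X4RankZero.bsdp_three_potMult_of_congr_of_places₇_of_primeList_paidAt
    (hKatoS : Kato2004.rankZero_padicValNat_sha_le_sub_localTamagawa_of_additive_potGood_of_imageContainsSL2)
    (hDel : Delbourgo1998.prop4_rankZero_pow_dvd_constantCoeff)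
    (hGZK : rank_eq_analyticRank_of_analyticRank_le_one) (hmod : hasEntireLFunction_rat)
    (hmodD : nonempty_modularParametrizationData)
    (hKatoχ : Wuthrich2014.kato_halfEigenCharIdeal_dvd_cyclotomicPrime_of_surjective)
    (hCT : exists_casselsTate_pairing (K := ℚ))
    (hU : Silverman1994_thmV53_tateUniformisation.{0})
    (hU2 : Silverman1994_thmV53_corV54_tateUniformisation.{0})
    (W : WeierstrassCurve ℚ) [W.IsElliptic] [W.IsGloballyMinimal] (hr : W.analyticRank = 0)
    (hX : haveI : Fact (Nat.Prime 3) := ⟨Nat.prime_three⟩; ClassX4 W 3)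
    (hsurj : W.HasSurjectiveModNGaloisRep 3) (hj : padicValRat 3 W.j < 0)
    {q : ℚ} (hq : shaAn W = (q : ℂ)) (hv : padicValRat 3 q ≤ 2)
    (W' : WeierstrassCurve ℚ) [W'.IsElliptic]
    (θ : geomTorsion W' ((3 : ℕ) : ℤ) ≃+ geomTorsion W ((3 : ℕ) : ℤ))
    (hθ : ∀ (σ : Field.absoluteGaloisGroup ℚ) (P : geomTorsion W' ((3 : ℕ) : ℤ)),
      θ (σ • P) = σ • θ P)
    (ℓ : ℕ) [Fact ℓ.Prime] (hℓ3 : ℓ ≠ 3)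
    {t k : ℕ} (htors : ∀ w : HeightOneSpectrum (𝓞 ℚ), (primesEquiv w : ℕ) = ℓ →
      Nat.card (nsmulAddMonoidHom 3 :
        (W'.baseChange (w.adicCompletion ℚ)).toAffine.Point →+ _).ker ≤ t)
    (hbudget : t < 3 ^ k) (hrank : k ≤ W'.mordellWeilRank)
    {E₀ F₀ : WeierstrassCurve ℤ} (hE : E₀.map (Int.castRingHom ℚ) = W)
    (hF : F₀.map (Int.castRingHom ℚ) = W') (L : List ℕ) (h3L : 3 ∈ L) (hℓL : ℓ ∈ L)
    (hΔE : ∀ q : ℕ, q.Prime → (q : ℤ) ∣ E₀.Δ → q ∈ L)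
    (hΔF : ∀ q : ℕ, q.Prime → (q : ℤ) ∣ F₀.Δ → q ∈ L)
    (hplaces : ∀ w : HeightOneSpectrum (𝓞 ℚ), (primesEquiv w : ℕ) ∈ L → (primesEquiv w : ℕ) ≠ ℓ →
      (((3 : ℕ) : 𝓞 ℚ) ∉ w.asIdeal ∧ Nat.card (nsmulAddMonoidHom 3 :
          (W'.baseChange (w.adicCompletion ℚ)).toAffine.Point →+ _).ker = 1) ∨
      (W.HasSplitMultiplicativeReductionAt w ∧ W'.HasSplitMultiplicativeReductionAt w ∧
        Nat.card (nsmulAddMonoidHom 3 :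
          (W.baseChange (w.adicCompletion ℚ)).toAffine.Point →+ _).ker ≤ 3) ∨
      (W.HasMultiplicativeReductionAt w ∧ W'.HasMultiplicativeReductionAt w ∧
        (∃ r : w.adicCompletion ℚ, algebraMap ℚ (w.adicCompletion ℚ) (-(W.c₄ / W.c₆)) =
          r ^ 2 * algebraMap ℚ (w.adicCompletion ℚ) (-(W'.c₄ / W'.c₆))) ∧
        (∀ ζ : w.adicCompletion ℚ, ζ ^ 3 = 1 → ζ = 1)) ∨
      (W.HasMultiplicativeReductionAt w ∧
        ¬ IsSquare (algebraMap ℚ (w.adicCompletion ℚ) (-(W.c₄ / W.c₆))) ∧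
        W'.HasGoodReductionAt w ∧ ((3 : ℕ) : 𝓞 ℚ) ∉ w.asIdeal) ∨
      (W.HasGoodReductionAt w ∧ W'.HasMultiplicativeReductionAt w ∧
        ¬ IsSquare (algebraMap ℚ (w.adicCompletion ℚ) (-(W'.c₄ / W'.c₆))) ∧
        ((3 : ℕ) : 𝓞 ℚ) ∉ w.asIdeal) ∨
      (1 < w.valuation ℚ W.j ∧ 1 < w.valuation ℚ W'.j ∧
        (∃ r : w.adicCompletion ℚ, algebraMap ℚ (w.adicCompletion ℚ) (-(W.c₄ / W.c₆)) =
          r ^ 2 * algebraMap ℚ (w.adicCompletion ℚ) (-(W'.c₄ / W'.c₆))) ∧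
        (∀ ζ : w.adicCompletion ℚ, ζ ^ 3 = 1 → ζ = 1)) ∨
      (W.HasAdditiveReductionAt w ∧ W'.HasAdditiveReductionAt w ∧ ((3 : ℕ) : 𝓞 ℚ) ∉ w.asIdeal ∧
        Nat.card (nsmulAddMonoidHom 3 :
          (W'.baseChange (w.adicCompletion ℚ)).toAffine.Point →+ _).ker = 3)) :
    haveI : Fact (Nat.Prime 3) := ⟨Nat.prime_three⟩
    BSDp W 3 := by
  haveI : Fact (Nat.Prime 3) := ⟨Nat.prime_three⟩
  obtain ⟨S, hS⟩ := exists_placeFinset_of_primeList L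
  obtain ⟨T, hTS, hT, hTℓ⟩ := exists_paidPlace_prime W' L ℓ hℓ3 hℓL hS htors hbudget hrank
  exact X4RankZero.bsdp_three_potMult_of_congr_of_places₇ hKatoS hDel hGZK hmod hmodD hKatoχ hCT W hr
    hX hsurj hj hq hv hU hU2 W' θ hθ S T hTS
    (good_and_not_mem_of_not_mem_placeFinset hE hF L Nat.prime_three h3L hΔE hΔF hS) hT
    (fun w hw hwT ↦ hplaces w ((hS w).mp hw) (hTℓ w hw hwT))

end Summit.BirchSwinnertonDyer.Rank1Residual.Additive

end
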